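import Summits.AtomisticToContinuum.Crystallization.Theorems.LayeredLawsSelectHcp.Negative.FccModel
import Summits.AtomisticToContinuum.Crystallization.Theorems.LayeredLawsSelectHcp.Negative.PeriodicPalmLaw
import Literature.MathematicalPhysics.StatisticalMechanics.PeriodicConfigurationSums

/-!
# Negative knowledge for crux `LayeredLawsSelectHcp` (stmt-AtomisticToContinuum-9226), V:
# H3 for the fcc Palm law is the lattice-sum inequality `e(fcc) ≤ e*`

Part V (`--supports stmt-AtomisticToContinuum-9226`). The fcc lattice `fccD3 a` as a
`PeriodicConfiguration 3` (`fccPC ha`: lattice `ℤ(1,1,0) + ℤ(1,0,1) + ℤ(0,1,1)` scaled by `a/√2`, motif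
`{0}`; `fccPC_points : (fccPC ha).points = fccD3 a` through `coe_span_d3Basis`, even-sum vectors being the
integer combinations of that basis), its energy per particle `e(fccPC a) = ½ ∑_{0 ≠ y ∈ fcc} V(‖y‖)`
(`energyPerParticle_fccPC`), and the identification of the mean root energy of the fcc law of part IV with
it: the Bochner integral `∫ V_LJ(‖y‖) d(count|fccD3 a)` IS the absolutely convergent lattice sum
(`PeriodicPalmLaw.count_restrict_eq_sum_dirac`, `integral_count_restrict_fccD3`, using
`PeriodicConfigurationSums.summable_lennardJones_dist_three` and Mathlib's `integral_sum_dirac_eq_tsum`; the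
root's own term is `V_LJ(0) = 0`), whence **`meanRootEnergy_fccLaw_eq_energyPerParticle :
E_{fccLaw a}[h] = e(fccPC a)`** and `eStar_le_energyPerParticle_fccPC : e* ≤ e(fccPC a)`. So hypothesis H3
of the crux, for the fcc law, is exactly the single real inequality `e(fccPC a) ≤ e*` — "fcc at
nearest-neighbour distance `a` minimises the Lennard-Jones energy per particle over all periodic
configurations of `ℝ³`"; with parts I–IV, that inequality at any `a ∈ [9/10, 1]` would refute the crux
(the one-line corollary is kept in `Cruxes/LayeredLawsSelectHcp/Disproof.lean`, its hypothesis being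
believed false: `Δ_{fcc/hcp}(12,6) = −1.00994·10⁻⁴`, Schwerdtfeger–Burrows–Smits 2021). All `[folklore]`.
-/

noncomputable section

namespace Summit.AtomisticToContinuum.Crystallization.Theorems.LayeredLawsSelectHcp.Negative.FccEnergy

open MeasureTheory Set
open Literature.MathematicalPhysics.StatisticalMechanics Literature.Geometry.DiscreteGeometry
open Summit.AtomisticToContinuum.Crystallization.Theses.PalmUnimodularRigidity (LayeredLawsSelectHcp)
open Summit.AtomisticToContinuum.Crystallization.Theorems.ChargedEnergyGapNegative
  (eStar eStar_le bddBelow_energyPerParticle_lennardJones)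

/-- Euclidean `3`-space. [folklore] -/
local notation "E3" => EuclideanSpace ℝ (Fin 3)
open Summit.AtomisticToContinuum.Crystallization.Theorems.LayeredLawsSelectHcp.Negative.DiracLaws
open Summit.AtomisticToContinuum.Crystallization.Theorems.LayeredLawsSelectHcp.Negative.IntegerForms
open Summit.AtomisticToContinuum.Crystallization.Theorems.LayeredLawsSelectHcp.Negative.FccLattice
open Summit.AtomisticToContinuum.Crystallization.Theorems.LayeredLawsSelectHcp.Negative.FccModel
open Summit.AtomisticToContinuum.Crystallization.Theorems.LayeredLawsSelectHcp.Negative.PeriodicPalmLaw (count_restrict_eq_sum_dirac)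

/-! ## §8 fcc as a `PeriodicConfiguration`; H3 for the fcc law IS "fcc is a periodic minimiser" -/

/-- The integer `D₃` basis `(1,1,0), (1,0,1), (0,1,1)`. [folklore] -/
def d3Int : Fin 3 → (Fin 3 → ℤ) := ![![1, 1, 0], ![1, 0, 1], ![0, 1, 1]]

/-- The real basis vectors `cs a • intVec (d3Int l)` of `fccD3 a`. [folklore] -/
def d3Vec (a : ℝ) (l : Fin 3) : E3 := cs a • intVec (d3Int l)

/-- Coordinates of the basis vectors. [folklore] -/
theorem d3Vec_apply (a : ℝ) (l i : Fin 3) : d3Vec a l i = cs a * (d3Int l i : ℝ) := by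
  simp [d3Vec, intVec_apply]

/-- `cs a ≠ 0` for `a ≠ 0`. [folklore] -/
theorem cs_ne_zero {a : ℝ} (ha : a ≠ 0) : cs a ≠ 0 := by
  unfold cs; exact mul_ne_zero ha (inv_ne_zero (by positivity))

/-- The three basis vectors are linearly independent (`a ≠ 0`). [folklore] -/
theorem linearIndependent_d3Vec {a : ℝ} (ha : a ≠ 0) : LinearIndependent ℝ (d3Vec a) := by
  have hc : cs a ≠ 0 := cs_ne_zero ha
  rw [Fintype.linearIndependent_iff]
  intro g hg
  have e0 := congrArg (fun x : E3 => x 0) hg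
  have e1 := congrArg (fun x : E3 => x 1) hg
  have e2 := congrArg (fun x : E3 => x 2) hg
  simp only [Fin.sum_univ_three, PiLp.add_apply, PiLp.smul_apply, PiLp.zero_apply, smul_eq_mul,
    d3Vec_apply, d3Int, Matrix.cons_val_zero, Matrix.cons_val_one, Matrix.cons_val_two,
    Matrix.tail_cons, Matrix.head_cons, Int.cast_one, Int.cast_zero, mul_one, mul_zero,
    add_zero, zero_add] at e0 e1 e2
  have h0 : g 0 * cs a = 0 := by linear_combination (e0 + e1 - e2) / 2
  have h1 : g 1 * cs a = 0 := by linear_combination (e0 - e1 + e2) / 2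
  have h2 : g 2 * cs a = 0 := by linear_combination (-e0 + e1 + e2) / 2
  intro i
  fin_cases i
  · exact (mul_eq_zero.1 h0).resolve_right hc
  · exact (mul_eq_zero.1 h1).resolve_right hc
  · exact (mul_eq_zero.1 h2).resolve_right hc

/-- The basis of `ℝ³` formed by the three vectors. [folklore] -/
def d3Basis {a : ℝ} (ha : a ≠ 0) : Module.Basis (Fin 3) ℝ E3 :=
  basisOfLinearIndependentOfCardEqFinrank (linearIndependent_d3Vec ha) (by simp)

/-- The basis is `d3Vec a`. [folklore] -/
@[simp] theorem coe_d3Basis {a : ℝ} (ha : a ≠ 0) : ⇑(d3Basis ha) = d3Vec a :=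
  coe_basisOfLinearIndependentOfCardEqFinrank _ _

/-- **`fccD3 a` is the `ℤ`-span of the basis** (even-sum vectors are integer combinations of
`(1,1,0), (1,0,1), (0,1,1)`). [folklore] -/
theorem coe_span_d3Basis {a : ℝ} (ha : a ≠ 0) :
    (Submodule.span ℤ (Set.range (d3Basis ha)) : Set E3) = (fccD3 a : Set E3) := by
  apply Set.Subset.antisymm
  · have hle : Submodule.span ℤ (Set.range (d3Basis ha)) ≤ (fccD3 a).toIntSubmodule :=
      Submodule.span_le.2 (by
        rintro _ ⟨l, rfl⟩
        rw [coe_d3Basis]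
        refine ⟨d3Int l, ?_, rfl⟩
        fin_cases l <;> decide)
    exact fun z hz => hle hz
  · rintro _ ⟨v, ⟨m, hm⟩, rfl⟩
    set L := Submodule.span ℤ (Set.range (d3Basis ha))
    have hb : ∀ l, d3Vec a l ∈ L := fun l => Submodule.subset_span ⟨l, by simp⟩
    have key : ∀ (n : ℤ) (x : E3), x ∈ L → (n : ℝ) • x ∈ L := fun n x hx => by
      rw [Int.cast_smul_eq_zsmul]; exact L.smul_mem n hx
    have hmr : (v 0 : ℝ) + v 1 + v 2 = m + m := by exact_mod_cast hm
    have hz : cs a • intVec v = ((m - v 2 : ℤ) : ℝ) • d3Vec a 0 + ((m - v 1 : ℤ) : ℝ) • d3Vec a 1 +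
        ((m - v 0 : ℤ) : ℝ) • d3Vec a 2 := by
      ext i
      fin_cases i <;>
        simp only [PiLp.add_apply, PiLp.smul_apply, smul_eq_mul, intVec_apply, d3Vec_apply, d3Int,
          Matrix.cons_val_zero, Matrix.cons_val_one, Matrix.cons_val_two, Matrix.tail_cons,
          Matrix.head_cons, Int.cast_one, Int.cast_zero, mul_one, mul_zero, add_zero, zero_add,
          Fin.zero_eta, Fin.mk_one, Fin.reduceFinMk] <;> push_cast <;> linear_combination (cs a) * hmr
    change cs a • intVec v ∈ L
    rw [hz]
    exact add_mem (add_mem (key _ _ (hb 0)) (key _ _ (hb 1))) (key _ _ (hb 2))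

/-- **The fcc lattice as a periodic configuration** (Bravais: motif `{0}`). [folklore] -/
def fccPC {a : ℝ} (ha : a ≠ 0) : PeriodicConfiguration 3 where
  lattice := Submodule.span ℤ (Set.range (d3Basis ha))
  discrete := by infer_instance
  isZLattice := by infer_instance
  motif := {0}
  motif_nonempty := Finset.singleton_nonempty 0
  eq_of_sub_mem := by
    intro x hx y hy _
    rw [Finset.mem_singleton] at hx hy
    rw [hx, hy]

/-- Its point set is `fccD3 a`. [folklore] -/
theorem fccPC_points {a : ℝ} (ha : a ≠ 0) : (fccPC ha).points = (fccD3 a : Set E3) := by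
  ext z
  simp only [PeriodicConfiguration.points, fccPC, Finset.mem_singleton, Set.mem_setOf_eq]
  rw [← coe_span_d3Basis ha]
  constructor
  · rintro ⟨y, rfl, g, hg, rfl⟩
    rw [zero_add]; exact hg
  · intro hz
    exact ⟨0, rfl, z, hz, (zero_add z).symm⟩

/-- Its energy per particle is `½ ∑_{0 ≠ y ∈ fccD3 a} V(‖y‖)`. [folklore] -/
theorem energyPerParticle_fccPC {a : ℝ} (ha : a ≠ 0) (V : ℝ → ℝ) :
    (fccPC ha).energyPerParticle V =
      (∑' y : {y : E3 // y ∈ (fccD3 a : Set E3) ∧ y ≠ 0}, V ‖(y : E3)‖) / 2 := by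
  unfold PeriodicConfiguration.energyPerParticle
  have hm : (fccPC ha).motif = {0} := rfl
  rw [hm, Finset.card_singleton, Finset.sum_singleton]
  let e : {y : E3 // y ∈ (fccD3 a : Set E3) ∧ y ≠ 0} ≃ {y : E3 // y ∈ (fccPC ha).points ∧ y ≠ 0} :=
    Equiv.subtypeEquivRight fun y => by rw [fccPC_points ha]
  rw [← Equiv.tsum_eq e]
  simp only [e, Equiv.subtypeEquivRight_apply_coe, dist_comm (0 : E3), dist_zero_right]
  push_cast
  ring

/-- The Lennard-Jones sum over the non-zero points of `fccD3 a` converges absolutely (it is the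
lattice sum of a periodic configuration of `ℝ³`). [folklore] -/
theorem summable_abs_lennardJones_fccD3 {a : ℝ} (ha : a ≠ 0) :
    Summable fun y : {y : E3 // y ∈ (fccD3 a : Set E3) ∧ y ≠ 0} => |lennardJones ‖(y : E3)‖| := by
  have h := ((fccPC ha).summable_lennardJones_dist_three 0).abs
  let e : {y : E3 // y ∈ (fccD3 a : Set E3) ∧ y ≠ 0} ≃ {y : E3 // y ∈ (fccPC ha).points ∧ y ≠ 0} :=
    Equiv.subtypeEquivRight fun y => by rw [fccPC_points ha]
  refine (e.summable_iff.2 h).congr fun y => ?_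
  simp [e, dist_comm (0 : E3), dist_zero_right]

/-- **The root energy of the fcc law is a genuine sum**: `∫ V_LJ(‖y‖) d(count|fccD3 a) =
∑_{0 ≠ y ∈ fccD3 a} V_LJ(‖y‖)` (the root's own term is `V_LJ(0) = 0`). [folklore] -/
theorem integral_count_restrict_fccD3 {a : ℝ} (ha : a ≠ 0) :
    ∫ y, lennardJones ‖y‖ ∂((Measure.count : Measure E3).restrict (fccD3 a : Set E3)) =
      ∑' y : {y : E3 // y ∈ (fccD3 a : Set E3) ∧ y ≠ 0}, lennardJones ‖(y : E3)‖ := by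
  set S : Set E3 := (fccD3 a : Set E3) with hSdef
  have hS : S.Countable := countable_fccD3 a
  have h0 : (0 : E3) ∈ S := (fccD3 a).zero_mem
  have hS' : (S \ {0}).Countable := hS.mono Set.sdiff_subset
  haveI : Countable ↥(S \ {0}) := hS'.to_subtype
  -- split off the root
  have hsplit : S = (S \ {0}) ∪ {0} := by
    rw [Set.sdiff_union_self, Set.union_eq_self_of_subset_right (Set.singleton_subset_iff.2 h0)]
  have hdisj : Disjoint (S \ {0}) {0} := Set.disjoint_sdiff_left
  -- the two subtypes of non-zero points coincide
  let e : ↥(S \ {0}) ≃ {y : E3 // y ∈ S ∧ y ≠ 0} :=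
    Equiv.subtypeEquivRight fun y => by simp
  -- summability of the tail
  have hsum : Summable fun i : ↥(S \ {0}) => ((1 : ENNReal)).toReal * ‖lennardJones ‖(i : E3)‖‖ := by
    simp only [ENNReal.toReal_one, one_mul, Real.norm_eq_abs]
    exact (e.summable_iff (f := fun y : {y : E3 // y ∈ S ∧ y ≠ 0} => |lennardJones ‖(y : E3)‖|)).2
      (summable_abs_lennardJones_fccD3 ha)
  have hrest : (Measure.count : Measure E3).restrict (S \ {0}) =
      Measure.sum fun i : ↥(S \ {0}) => (1 : ENNReal) • Measure.dirac (i : E3) :=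
    count_restrict_eq_sum_dirac hS'
  have hint1 : Integrable (fun y : E3 => lennardJones ‖y‖) ((Measure.count : Measure E3).restrict (S \ {0})) := by
    rw [hrest]; exact integrable_sum_dirac (fun _ => ENNReal.one_ne_top) hsum
  have hint0 : Integrable (fun y : E3 => lennardJones ‖y‖) ((Measure.count : Measure E3).restrict {0}) := by
    rw [Measure.restrict_singleton, Measure.count_singleton, one_smul]
    exact integrable_dirac (by simp)
  have hI := integral_sum_dirac_eq_tsum (f := fun y : E3 => lennardJones ‖y‖)
    (x := fun i : ↥(S \ {0}) => (i : E3)) (fun _ => ENNReal.one_ne_top) hsum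
  conv_lhs => rw [hsplit]
  rw [Measure.restrict_union hdisj (measurableSet_singleton 0), integral_add_measure hint1 hint0,
    Measure.restrict_singleton, Measure.count_singleton, one_smul, integral_dirac, norm_zero,
    lennardJones_zero, add_zero, hrest, hI]
  simp only [ENNReal.toReal_one, one_smul]
  exact Equiv.tsum_eq e (fun y : {y : E3 // y ∈ S ∧ y ≠ 0} => lennardJones ‖(y : E3)‖)

/-- **H3 for the fcc law is exactly "fcc is a periodic Lennard-Jones minimiser"**:
`E_{fccLaw a}[h] = e(fccPC a)` (and `e* ≤ e(fccPC a)` always, `eStar_le`). [folklore] -/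
theorem meanRootEnergy_fccLaw_eq_energyPerParticle {a : ℝ} (ha : a ≠ 0) :
    meanRootEnergy (fccLaw a) = (fccPC ha).energyPerParticle lennardJones := by
  rw [meanRootEnergy_fccLaw, integral_count_restrict_fccD3 ha, energyPerParticle_fccPC ha]

/-- `e* ≤ e(fccPC a)` holds unconditionally (item 0714, `eStar_le`), so H3 for the fcc law is the
single real inequality `e(fccPC a) ≤ e*` ("fcc is a periodic Lennard-Jones minimiser"). [folklore] -/
theorem eStar_le_energyPerParticle_fccPC {a : ℝ} (ha : a ≠ 0) :
    eStar ≤ (fccPC ha).energyPerParticle lennardJones :=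
  eStar_le _

end Summit.AtomisticToContinuum.Crystallization.Theorems.LayeredLawsSelectHcp.Negative.FccEnergy

end
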